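import Summits.CriticalPhenomena.SAWScalingLimit.Theorems.SAWLeftRightFKGFKGToTraversalBoundWitnessCfg
import Summits.CriticalPhenomena.SAWScalingLimit.Theorems.SAWLeftRightFKGFKGToTraversalBoundOutlinePeriod
import Summits.CriticalPhenomena.SAWScalingLimit.Theorems.SAWLeftRightFKGFKGToTraversalBoundOutlineCycle
import HarnessLib

/-!
# Witness glue T7, part 1: the tour data of the free component, the trivial witness, the rank bound
(crux `SAWLeftRightFKG.FKGToTraversalBound`, stmt-CriticalPhenomena-1878; line `slit-necklace`,
registered stub `final_tour_data` — a part file of the final assembly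
`necklaceWitnessFarU_of_boundaryBudget : BoundaryBudget → NecklaceWitnessFarU`)

Setting: a far-tip configuration `cfg : FarTipCfg D` (…WitnessCfg) and the free component `F` of its first tip
produced by `witness_setup` (…WitnessSetup): a finite `4`-connected site set with `4`-connected complement
containing both tips `t₀ = γ τ`, `t₁ = γ τ'`, NOT containing the stub vertices `γ (τ - 1)`, `γ (τ' + 1)`, which are
lattice-adjacent to `t₀`, `t₁` respectively, and `t₀ ≠ t₁`.

* `final_tour_data`: the boundary edge `e₀ = (t₀ → γ (τ - 1))` of `F` (`exists_isBEdge_of_adj`), its minimal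
  injective tour period `N` (`btour_minimalPeriod_surj`), and an index `0 < n₁ < N` at which the wall-follower tour
  of the outline of `F` passes the boundary edge `(t₁ → γ (τ' + 1))` (`btour_transitive`: the outline of a
  `4`-connected set with `4`-connected complement is ONE tour; `n₁ ≠ 0` because the two outline sites differ).
* `final_hasFarTipWitness_self`: the degenerate far-tip piece `τ = τ'` has the one-vertex witness.
* `final_rk_le_nfar`: the rank of …WitnessCfg is at most the number of far pieces (far starts are spine indices,
  hence `≤ |γ|`; `rk_le_nfar`).

Pure bookkeeping; no literature fact.
-/

noncomputable section

open Set SimpleGraph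
open Literature.Probability.LatticeModels
open Literature.Probability.RandomPlanarGeometry
open Summit.CriticalPhenomena.SAWScalingLimit.Theorems.FKGToTraversalBound.Negative (dom)

namespace Summit.CriticalPhenomena.SAWScalingLimit.Theorems.FKGToTraversalBound.SlitNecklace

/-- **The trivial far-tip witness.**  If the far-tip piece is degenerate (`τ = τ'`), the nil walk at `γ τ` is a
witness for every positive window budget: its only vertex is off the spine, differs from every other vertex of the
self-avoiding chord, and a window with both ends at the same point cannot cross a genuine shell. [folklore] -/
theorem final_hasFarTipWitness_self {Ω : Set ℂ} {δ : ℝ} {Sp : Set (Site 2)} {a₀ b₀ : Site 2}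
    {p : (discreteDomainGraph Ω δ).Walk a₀ b₀} (hp : p.IsPath) {τ k : ℕ} (hk : 0 < k) (hτ : τ ≤ p.length)
    (hSp : p.getVert τ ∉ Sp) {y : ℂ} {σ₁ σ₂ : ℝ} (hσ : σ₁ < σ₂) :
    HasFarTipWitness Ω δ Sp p τ τ k y σ₁ σ₂ := by
  refine ⟨le_rfl, hτ, Walk.nil, Walk.IsPath.nil, ?_, ?_⟩
  · intro z hz
    rw [Walk.support_nil, List.mem_singleton] at hz
    subst hz
    refine ⟨hSp, fun m hm hne h => ?_⟩
    have := hp.getVert_injOn (by exact hτ) (by exact hm) h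
    omega
  · rintro ⟨a, b, -, hside, -⟩
    rcases hside ⟨0, hk⟩ with h | h <;> simp only [Walk.getVert_nil] at h <;> linarith [h.1, h.2]

/-- **The rank is at most the number of far pieces** (every far start is a spine index, hence `≤ |γ|`, so
`rk_le_nfar` applies). [folklore] -/
theorem final_rk_le_nfar {D : DobrushinDomain} (cfg : PresCfg D) (i' : ℕ) : cfg.rk i' ≤ cfg.nfar :=
  rk_le_nfar cfg i' fun _ ⟨_, hfp⟩ => hfp.1.1.1

/-- **Tour data of the free component** (registered stub `final_tour_data`).  For the free component `F` of the
first tip (both tips in `F`, `F` `4`-connected with `4`-connected complement, the stub vertices `γ (τ - 1)`,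
`γ (τ' + 1)` outside `F` and lattice-adjacent to `t₀`, `t₁`, and `t₀ ≠ t₁`): the boundary edge `e₀` of `F` at
`t₀` with contact `γ (τ - 1)`, its minimal injective tour period `N`, and an index `0 < n₁ < N` at which the tour
is the boundary edge at `t₁` with contact `γ (τ' + 1)`. [folklore] -/
theorem final_tour_data : ∀ {D : DobrushinDomain} (cfg : FarTipCfg D) (F : Finset (Site 2)), cfg.t₀ ∈ F → cfg.t₁ ∈ F → (∀ x ∈ F, ∀ y ∈ F, ∃ p : (zdGraph 2).Walk x y, ∀ z ∈ p.support, z ∈ F) → (∀ x y : Site 2, x ∉ F → y ∉ F → ∃ p : (zdGraph 2).Walk x y, ∀ z ∈ p.support, z ∉ F) → cfg.γ.getVert (cfg.τ - 1) ∉ F → cfg.γ.getVert (cfg.τ' + 1) ∉ F → (zdGraph 2).Adj cfg.t₀ (cfg.γ.getVert (cfg.τ - 1)) → (zdGraph 2).Adj cfg.t₁ (cfg.γ.getVert (cfg.τ' + 1)) → cfg.t₀ ≠ cfg.t₁ → ∃ (e₀ : Site 2 × ODir) (n₁ N : ℕ), IsBEdge (↑F : Set (Site 2)) e₀ ∧ bsite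 e₀ = cfg.t₀ ∧ bcontact e₀ = cfg.γ.getVert (cfg.τ - 1) ∧ 0 < n₁ ∧ n₁ < N ∧ btour (↑F : Set (Site 2)) e₀ N = e₀ ∧ (∀ j j', j < N → j' < N → btour (↑F : Set (Site 2)) e₀ j = btour (↑F : Set (Site 2)) e₀ j' → j = j') ∧ bsite (btour (↑F : Set (Site 2)) e₀ n₁) = cfg.t₁ ∧ bcontact (btour (↑F : Set (Site 2)) e₀ n₁) = cfg.γ.getVert (cfg.τ' + 1) := by
  intro D cfg F ht₀ ht₁ hconn hcompl hprev hnext hadj₀ hadj₁ hne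
  obtain ⟨d₀, he₀, hc₀⟩ := exists_isBEdge_of_adj (↑F : Set (Site 2)) (Finset.mem_coe.2 ht₀)
    (fun h => hprev (Finset.mem_coe.1 h)) hadj₀
  obtain ⟨d₁, he₁, hc₁⟩ := exists_isBEdge_of_adj (↑F : Set (Site 2)) (Finset.mem_coe.2 ht₁)
    (fun h => hnext (Finset.mem_coe.1 h)) hadj₁
  obtain ⟨N, -, hper, hinj, hsurj⟩ := btour_minimalPeriod_surj F he₀
  obtain ⟨l, hl⟩ := btour_transitive F ⟨_, ht₀⟩ hconn hcompl _ _ he₀ he₁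
  obtain ⟨n₁, hn₁N, hn₁⟩ := hsurj l
  rw [hl] at hn₁
  refine ⟨(cfg.t₀, d₀), n₁, N, he₀, rfl, hc₀, ?_, hn₁N, hper, hinj, ?_, ?_⟩
  · refine Nat.pos_of_ne_zero fun h => hne ?_
    rw [h, btour_zero] at hn₁
    exact (congrArg Prod.fst hn₁).symm
  · rw [← hn₁]; rfl
  · rw [← hn₁]; exact hc₁

end Summit.CriticalPhenomena.SAWScalingLimit.Theorems.FKGToTraversalBound.SlitNecklace

end
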